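import Mathlib
import Summits.KontsevichZagierPeriods.KontsevichZagierPeriods.Theorems.TorsionLogsNeronTorsionSectorStubDlogPotential
import Summits.KontsevichZagierPeriods.KontsevichZagierPeriods.Theorems.TorsionLogsNeronTorsionSectorStubUpperRegularAux
import HarnessLib

/-!
# Stub `stub_upperRegular` — crux `TorsionLogs.NeronTorsionSector` (stmt-KontsevichZagierPeriods-14500),
line `registered`, block V3: real analysis of the upper branch right of `x₁`

Upper branch `ybp = +√f` of `y² = f(x) = 4x³ − g₂x − g₃` on `(x₁, ∞)`, translated by
`P₁ = (x₁, y₁)` (`y₁ < 0`) in regular chord form (`slp = M/(√f + y₁)`, `τp = slp²/4 − x − x₁`,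
`Y3p`, `Qfp`, the iterated chord `sl3p`, `X33p`, `Y33p`, `Qf3p`, the polynomial `Pgp` and the dlog
potential `Gp`, exactly as in the landed `stub_translationCalculus` / `stub_dlogPotential` with
`ε = +1`). The analysis (sign lemma, `M > 0`, boundedness of `Qfp` near `x₁`, semialgebraicity) is in
the auxiliary file (`upperReg_*`); here we assemble the registered statement: (1) signs on `(x₁, ∞)`;
(2) Haar invariance `|τp′|√f = √f∘τp`; (3) `e₁ ≤ X33p`, `Pgp ≠ 0`, the dlog identity
(`stub_dlogPotential` (i)) and the composite formulas `Qf3p = Qf∘τp`, `X33p = τ∘τp`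
(`Y3p = yb∘τp`); (4) `Qfp′` (`stub_translationCalculus` (c)); (5) boundedness; (6) semialgebraicity.

References: J. H. Silverman, *The Arithmetic of Elliptic Curves* (2nd ed., 2009), III.2.3 and
III.5.1; S. Lang, *Fundamentals of Diophantine Geometry* (1983), Ch. 13 Thm 1.1.
-/

noncomputable section

-- `Summit.KontsevichZagierPeriods.KontsevichZagierPeriods.…` is the tree's mandated layout (single-conjunct summit).
set_option linter.dupNamespace false

open Set
open Literature.NumberTheory.Transcendental Literature.ModelTheory.ExponentialFields

namespace Summit.KontsevichZagierPeriods.KontsevichZagierPeriods.Cruxes.NeronTorsionSector.Translation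

/-! ### The registered stub -/

/-- **STUB V3 (`stub_upperRegular`) — real analysis of the upper branch right of `x₁`.** Upper
branch `ybp = +√f` on `(x₁, ∞)`, translation `τp` by `P₁ = (x₁, y₁)` (`y₁ < 0`) in regular chord
form: (1) `√f + y₁ > 0`, `slp > 0`, `x₁ < τp x` and `Y3p < 0` (sign lemma `upperReg_sign`: the
chord cubic `f(t) − ℓ(t)² = 4(t − x₁)(t − x)(t − τp x)` is positive at the zero of the line), so
`Y3p = −√f∘τp` and `Y3p + y₁ < 0`; (2) Haar invariance `|τp′|√f = √f∘τp` (`τp′ = Y3p/ybp`,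
`stub_translationCalculus`); (3) `e₁ ≤ X33p` (the same factorisation at `e₁`), `Pgp ≠ 0` (norm
identity, `x ≠ x₂`), the dlog identity of `stub_dlogPotential` (i) (`ε = 1`) and `Qf3p = Qf∘τp`,
`X33p = τ∘τp` (lower-branch formulas at the translated point, `Y3p = yb∘τp`); (4)
`Qfp′ = (h∘τp − h)/ybp`; (5) `Qfp` is bounded on `(x₁, x₁ + 1]` (regularised form
`2D(Mx − √f·D)/(M² − 4(x + x₁)D²) − √f/(2x)`, `D = √f + y₁`, continuous on `[x₁, x₁ + 1]`);
(6) `ℚ`-semialgebraicity (closure rules). [cite: SilvermanAEC2009, III.2.3]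
[cite: Lang1983, Ch. 13 Thm 1.1] [cite: BochnakCosteRoy1998, Prop. 2.2.6] -/
theorem stub_upperRegular :
    ∀ (g₂ g₃ e₁ x₁ y₁ x₂ L₁ : ℝ)
      (f yb sl τ Y3 Qf ybp slp τp Y3p Qfp sl3p X33p Y33p Qf3p Pgp Gp τp' : ℝ → ℝ),
    (∀ x, f x = 4 * x ^ 3 - g₂ * x - g₃) → f e₁ = 0 → 0 < e₁ → (∀ x, e₁ < x → 0 < f x) →
    e₁ < x₁ → y₁ ^ 2 = f x₁ → y₁ < 0 →
    L₁ = (12 * x₁ ^ 2 - g₂) / (2 * y₁) → x₂ = L₁ ^ 2 / 4 - 2 * x₁ → e₁ < x₂ → x₂ < x₁ →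
    IsAlgebraic ℚ g₂ → IsAlgebraic ℚ g₃ → IsAlgebraic ℚ x₁ → IsAlgebraic ℚ y₁ →
    yb = (fun x => -Real.sqrt (f x)) →
    sl = (fun x => (4 * x ^ 2 + 4 * x * x₁ + 4 * x₁ ^ 2 - g₂) / (yb x + y₁)) →
    τ = (fun x => sl x ^ 2 / 4 - x - x₁) →
    Y3 = (fun x => -(yb x + sl x * (τ x - x))) →
    Qf = (fun x => sl x / 2 + Y3 x / (2 * τ x) - yb x / (2 * x)) →
    ybp = (fun x => Real.sqrt (f x)) →
    slp = (fun x => (4 * x ^ 2 + 4 * x * x₁ + 4 * x₁ ^ 2 - g₂) / (ybp x + y₁)) →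
    τp = (fun x => slp x ^ 2 / 4 - x - x₁) →
    Y3p = (fun x => -(ybp x + slp x * (τp x - x))) →
    Qfp = (fun x => slp x / 2 + Y3p x / (2 * τp x) - ybp x / (2 * x)) →
    sl3p = (fun x => (4 * τp x ^ 2 + 4 * τp x * x₁ + 4 * x₁ ^ 2 - g₂) / (Y3p x + y₁)) →
    X33p = (fun x => sl3p x ^ 2 / 4 - τp x - x₁) →
    Y33p = (fun x => -(Y3p x + sl3p x * (X33p x - τp x))) →
    Qf3p = (fun x => sl3p x / 2 + Y33p x / (2 * X33p x) - Y3p x / (2 * τp x)) →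
    Pgp = (fun x => 4 * (x + 2 * x₁) * y₁ - L₁ * (4 * x ^ 2 + 4 * x * x₁ + 4 * x₁ ^ 2 - g₂)
      + 4 * (x + 2 * x₁) * ybp x) →
    Gp = (fun x => Pgp x / (ybp x + y₁) ^ 2 * Real.sqrt (x * X33p x) / τp x) →
    τp' = (fun x => Y3p x / ybp x) →
    (∀ x, x₁ < x → 0 < ybp x + y₁ ∧ 0 < slp x ∧ x₁ < τp x ∧ Y3p x < 0 ∧
      Y3p x = -Real.sqrt (f (τp x)) ∧ Y3p x + y₁ < 0) ∧
    (∀ x, x₁ < x →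
      HasDerivAt τp (τp' x) x ∧ τp' x ≠ 0 ∧ |τp' x| * Real.sqrt (f x) = Real.sqrt (f (τp x))) ∧
    (∀ x, x₁ < x → e₁ ≤ X33p x ∧ Pgp x ≠ 0 ∧ Gp x ≠ 0 ∧
      HasDerivAt Gp (Gp x * ((Qf3p x - Qfp x) / ybp x)) x ∧ Qf3p x = Qf (τp x) ∧
      X33p x = τ (τp x)) ∧
    (∀ x, x₁ < x →
      HasDerivAt Qfp (((g₂ * τp x + 2 * g₃) / (4 * τp x ^ 2) - (g₂ * x + 2 * g₃) / (4 * x ^ 2)) / ybp x) x) ∧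
    (∃ Mb : ℝ, ∀ x ∈ Set.Ioc x₁ (x₁ + 1), |Qfp x| ≤ Mb) ∧
    (∀ S : Set ℝ, IsSemialgebraic ℚ {t : Fin 1 → ℝ | t 0 ∈ S} →
      IsSemialgebraicFunOn ℚ {t : Fin 1 → ℝ | t 0 ∈ S} (fun t => τp (t 0)) ∧
      IsSemialgebraicFunOn ℚ {t : Fin 1 → ℝ | t 0 ∈ S} (fun t => Y3p (t 0)) ∧
      IsSemialgebraicFunOn ℚ {t : Fin 1 → ℝ | t 0 ∈ S} (fun t => Qfp (t 0)) ∧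
      IsSemialgebraicFunOn ℚ {t : Fin 1 → ℝ | t 0 ∈ S} (fun t => Qf3p (t 0)) ∧
      IsSemialgebraicFunOn ℚ {t : Fin 1 → ℝ | t 0 ∈ S} (fun t => Gp (t 0)) ∧
      IsSemialgebraicFunOn ℚ {t : Fin 1 → ℝ | t 0 ∈ S} (fun t => ybp (t 0)) ∧
      IsSemialgebraicFunOn ℚ {t : Fin 1 → ℝ | t 0 ∈ S} (fun t => τp' (t 0))) := by
  intro g₂ g₃ e₁ x₁ y₁ x₂ L₁ f yb sl τ Y3 Qf ybp slp τp Y3p Qfp sl3p X33p Y33p Qf3p Pgp Gp τp'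
    hf hfe₁ he₁ hfpos hx₁ hy₁ hy₁neg hL₁ hx₂ _hex₂ hx₂₁ ag₂ ag₃ ax₁ ay₁
    hyb hsl hτ hY3 hQf hybp hslp hτp hY3p hQfp hsl3p hX33p hY33p hQf3p hPgp hGp hτp'
  -- the branch in the `ε = 1` normal form of the imported stubs
  have hyb1 : ybp = fun x => 1 * Real.sqrt (f x) := by rw [hybp]; simp
  have hy₁' : y₁ ^ 2 = 4 * x₁ ^ 3 - g₂ * x₁ - g₃ := hy₁.trans (hf x₁)
  have key := fun t (ht : x₁ < t) =>
    upperReg_key hf hfe₁ he₁ hfpos hx₁ hy₁ hy₁neg hybp hslp hτp hY3p ht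
  obtain ⟨-, hTCb, hTCc, -⟩ := stub_translationCalculus g₂ g₃ x₁ y₁ 1 f ybp slp τp Y3p Qfp hf
    hy₁ (Or.inl rfl) hyb1 hslp hτp hY3p hQfp
  refine ⟨?_, ?_, ?_, ?_, upperReg_bounded hf hfe₁ he₁ hfpos hx₁ hy₁ hy₁neg hybp hslp hτp hY3p hQfp,
    fun S hS => upperReg_semialg hf hL₁ ag₂ ag₃ ax₁ ay₁ hybp hslp hτp hY3p hQfp hsl3p hX33p hY33p
      hQf3p hPgp hGp hτp' hS⟩
  · -- (1) signs on `(x₁, ∞)`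
    intro x hx
    obtain ⟨-, -, -, hD, -, -, hs, hτgt, hY3neg, hY3eq⟩ := key x hx
    exact ⟨hD, hs, hτgt, hY3neg, hY3eq, add_neg hY3neg hy₁neg⟩
  · -- (2) Haar invariance of `dx/√f`
    intro x hx
    obtain ⟨hfx, hYx, hYpos, hD, -, -, -, -, hY3neg, hY3eq⟩ := key x hx
    have hder : HasDerivAt τp (Y3p x / ybp x) x := hTCb x hfx hD.ne'
    have hτ'x : τp' x = Y3p x / ybp x := by rw [hτp']
    refine ⟨by rw [hτ'x]; exact hder, by rw [hτ'x]; exact div_ne_zero hY3neg.ne hYpos.ne', ?_⟩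
    rw [hτ'x, abs_div, abs_of_neg hY3neg, abs_of_pos hYpos, hY3eq, neg_neg, hYx,
      div_mul_cancel₀ _ (Real.sqrt_pos.2 hfx).ne']
  · -- (3) the iterated chord, `Pgp ≠ 0`, the dlog identity, the composite formulas
    intro x hx
    obtain ⟨hfx, hYx, hYpos, hD, hM, hch, hs, hτgt, hY3neg, hY3eq⟩ := key x hx
    have hxe : e₁ < x := hx₁.trans hx
    have hxpos : 0 < x := he₁.trans hxe
    have hτpos : 0 < τp x := (he₁.trans hx₁).trans hτgt
    have hD3 : Y3p x + y₁ < 0 := add_neg hY3neg hy₁neg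
    -- the chord through `(τp x, Y3p x)` and `P₁`
    have hon : Y3p x ^ 2 = f (τp x) := by
      rw [hY3eq, neg_sq]
      exact Real.sq_sqrt (hfpos _ (hx₁.trans hτgt)).le
    have hsl3x : sl3p x = (4 * τp x ^ 2 + 4 * τp x * x₁ + 4 * x₁ ^ 2 - g₂) / (Y3p x + y₁) := by
      rw [hsl3p]
    have hM3 : sl3p x * (Y3p x + y₁) = 4 * τp x ^ 2 + 4 * τp x * x₁ + 4 * x₁ ^ 2 - g₂ := by
      rw [hsl3x]; exact div_mul_cancel₀ _ hD3.ne
    have hch3 : Y3p x - y₁ = sl3p x * (τp x - x₁) :=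
      translCalc_chord (hon.trans (hf _)) hy₁' hM3 hD3.ne
    have hX33x : X33p x = sl3p x ^ 2 / 4 - τp x - x₁ := by rw [hX33p]
    have hX33 : e₁ ≤ X33p x := by
      rw [hX33x]
      exact upperReg_third_ge ((hf e₁).symm.trans hfe₁) hx₁ (hx₁.trans hτgt) hy₁' hM3 hch3
    -- the norm identity ⇒ `Pgp ≠ 0`; the dlog identity
    obtain ⟨hDP1, hDP2, -, -⟩ := stub_dlogPotential g₂ g₃ x₁ y₁ x₂ (-(y₁ + L₁ * (x₂ - x₁))) L₁ 1
      f ybp slp τp Y3p Qfp sl3p X33p Y33p Qf3p Pgp Gp hf hy₁ hy₁neg.ne (Or.inl rfl) hL₁ hx₂ rfl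
      hyb1 hslp hτp hY3p hQfp hsl3p hX33p hY33p hQf3p hPgp hGp
    have hPx : Pgp x = 4 * (x + 2 * x₁) * y₁ - L₁ * (4 * x ^ 2 + 4 * x * x₁ + 4 * x₁ ^ 2 - g₂)
        + 4 * (x + 2 * x₁) * ybp x := by rw [hPgp]
    have hP : Pgp x ≠ 0 := by
      rw [hPx]
      exact upperReg_Pg_ne (by rw [hYx]; exact Real.sq_sqrt hfx.le)
        (upperReg_M_pos hf hfe₁ he₁ hfpos hx₁ hxe) (hx₂₁.trans hx) (hDP2 x)
    obtain ⟨hGd, hG0⟩ := hDP1 x hfx hD.ne' hD3.ne hτpos (he₁.trans_le hX33) hxpos hP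
    -- the lower-branch formulas at the translated point
    have hybτ : yb (τp x) = Y3p x := by rw [hyb, hY3eq]
    have hslτ : sl (τp x) = sl3p x := by
      rw [hsl, hsl3x]
      simp only [hybτ]
    have hττ : τ (τp x) = X33p x := by
      rw [hτ, hX33x]
      simp only [hslτ]
    have hY33x : Y33p x = -(Y3p x + sl3p x * (X33p x - τp x)) := by rw [hY33p]
    have hY3τ : Y3 (τp x) = Y33p x := by
      rw [hY3, hY33x]
      simp only [hybτ, hslτ, hττ]
    have hQf3x : Qf3p x = sl3p x / 2 + Y33p x / (2 * X33p x) - Y3p x / (2 * τp x) := by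
      rw [hQf3p]
    have hQfτ : Qf (τp x) = Qf3p x := by
      rw [hQf, hQf3x]
      simp only [hslτ, hY3τ, hττ, hybτ]
    exact ⟨hX33, hP, hG0, hGd, hQfτ.symm, hττ.symm⟩
  · -- (4) the derivative of the cocycle potential
    intro x hx
    obtain ⟨hfx, -, -, hD, -, -, -, hτgt, -, -⟩ := key x hx
    have hxpos : 0 < x := he₁.trans (hx₁.trans hx)
    have hτpos : 0 < τp x := (he₁.trans hx₁).trans hτgt
    exact hTCc x hfx hD.ne' hτpos.ne' hxpos.ne'

end Summit.KontsevichZagierPeriods.KontsevichZagierPeriods.Cruxes.NeronTorsionSector.Translation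

end
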